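import Summits.BirchSwinnertonDyer.BirchSwinnertonDyer.Theorems.ByReductionTypeAtTwoOrdIsogenyDualMaps
import Summits.BirchSwinnertonDyer.BirchSwinnertonDyer.Theorems.ByReductionTypeAtTwoOrdEisensteinHalfShaIsogeny
import Literature.NumberTheory.EllipticCurves.IsogenyFrobeniusTraceProofs
import Literature.NumberTheory.EllipticCurves.BSDSelmerCMPConverseMaximalOrderProofs
import Summits.BirchSwinnertonDyer.Rank1Residual.Additive.TameBranchAnalyticShaLaw
import HarnessLib

/-!
# Rescaling in `Λ` and bookkeeping along an isogeny at `2` (prelude to the `μ`-shift law; route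
# ByReductionTypeAtTwo / TwoAdicConverse, cruxes `OrdKatoHalfAtTwo` / `OrdEisensteinHalfAtTwo`,
# item stmt-BirchSwinnertonDyer-19272; seat bsd-2adic-ord-3, GEN 3)

HONEST FRAMING (cell `bsd-2adic`, HUMAN RULINGS D-0036/D-0074): THEOREMS ONLY — no definition, no named
fact, nothing asserted, closes nothing.

* Rescaling lemmas in `Λ = ℤ_p⟦T⟧` (any `p`): if `ι L = x · ι G` (`x ∈ ℚ_p ∖ 0`, `G, L ∈ Λ ∖ 0`) then
  `ord_p x + μ(G) ≥ 0` and `μ(L) = ord_p x + μ(G)` (`mu_eq_of_iwasawaToPowerSeries_eq_C_mul`); conversely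
  such an integral `L` exists as soon as `ord_p x + μ(G) ≥ 0` (`exists_integral_rescale`). This is what
  makes Néron integrality of `ϖ·L₂(E)` at one member of an isogeny class a CONSEQUENCE of the Kato half
  at another (sequel `…OrdIsogenyMuShift`).
* Bookkeeping along a `ℚ`-isogeny `W ∼ W'`: good ordinary reduction at `2`, the unit root `α`, and
  `L(E,1) ≠ 0` are isogeny invariants (Faltings / *AEC* VII.7.2 / Knapp 11.67 — tree theorems).

References: L. Washington, GTM 83, §7.1 and §13.2; J. H. Silverman, *AEC*, VII.7.2; A. Knapp, *Elliptic
Curves*, Thm. 11.67; B. Mazur, J. Tate, J. Teitelbaum, Invent. Math. 84 (1986), §I.12.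
-/

set_option autoImplicit false
set_option linter.dupNamespace false

noncomputable section

open scoped Classical MatrixGroups ModularForm

open CongruenceSubgroup WeierstrassCurve Literature.NumberTheory.EllipticCurves
  Literature.NumberTheory.EllipticCurves.ModularForms Literature.NumberTheory.EllipticCurves.Rank1Residual
  Literature.NumberTheory.EllipticCurves.Rank1Residual.Typed
  Summit.BirchSwinnertonDyer.Rank1Residual.X1.MuLambda
  Summit.BirchSwinnertonDyer.Rank1Residual.X1.MuPart
  Summit.BirchSwinnertonDyer.Rank1Residual.X1.ParitySqueeze
  Summit.BirchSwinnertonDyer.Rank1Residual Summit.BirchSwinnertonDyer.Rank1Residual.X5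
  Summit.BirchSwinnertonDyer.BirchSwinnertonDyer.Theorems.EisensteinShaCurrency
  Summit.BirchSwinnertonDyer.BirchSwinnertonDyer.Theorems.LambdaConstPinch
  Summit.BirchSwinnertonDyer.Rank1Residual.Additive.TameBranchLambdaParity
  Summit.BirchSwinnertonDyer.Rank1Residual.Additive

universe u

namespace Summit.BirchSwinnertonDyer.BirchSwinnertonDyer.Theorems.IsogenyMuShift

/-! ## §1 Bookkeeping along an isogeny; rescaling in `Λ` -/

section Rescale

variable {p : ℕ} [Fact p.Prime]

/-- `ι (C c) = C c` for a constant `c ∈ ℤ_p`. [folklore] -/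
theorem iwasawaToPowerSeries_C (c : ℤ_[p]) :
    iwasawaToPowerSeries p (PowerSeries.C c) = PowerSeries.C (c : ℚ_[p]) := by
  rw [iwasawaToPowerSeries, PowerSeries.map_C]
  rfl

/-- `μ(C c · G₀) = ord_p c` when `c ≠ 0` and `G₀ ≢ 0 (mod p)`. [folklore] -/
theorem mu_C_mul_of_red_ne_zero {c : ℤ_[p]} (hc : c ≠ 0) {G₀ : IwasawaAlgebra p} (h₀ : red G₀ ≠ 0) :
    mu (PowerSeries.C c * G₀) = c.valuation := by
  have hG₀ : G₀ ≠ 0 := by rintro rfl; exact h₀ (by simp [red])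
  have hC0 : (PowerSeries.C c : IwasawaAlgebra p) ≠ 0 := by
    rw [Ne, ← map_zero (PowerSeries.C (R := ℤ_[p])), PowerSeries.C_injective.eq_iff]; exact hc
  have hμ₀ : mu G₀ = 0 := (mu_eq_and_pfree_eq h₀ (by rw [pow_zero, map_one, one_mul])).1
  rw [mu_mul hC0 hG₀, (mu_C_and_pfree_C hc).1, hμ₀, add_zero]

/-- The reduction mod `p` of `C u · G₀` is non-zero for a unit `u` and `G₀ ≢ 0`. [folklore] -/
theorem red_C_mul_ne_zero_of_isUnit {u : ℤ_[p]} (hu : IsUnit u) {G₀ : IwasawaAlgebra p}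
    (h₀ : red G₀ ≠ 0) : red (PowerSeries.C u * G₀) ≠ 0 := by
  obtain ⟨u', rfl⟩ := hu
  rw [red, map_mul]
  exact mul_ne_zero (red_C_units_ne_zero u') h₀

/-- **Rescaling, existence.** `G ∈ Λ ∖ 0`, `x ∈ ℚ_p ∖ 0` with `ord_p x + μ(G) ≥ 0`: there is `L ∈ Λ`
with `ι L = x · ι G`, namely `L = C(x·p^{μ(G)}) · pfree G`, and `μ(L) = ord_p x + μ(G)`. [folklore] -/
theorem exists_integral_rescale {G : IwasawaAlgebra p} (hG : G ≠ 0) {x : ℚ_[p]} (hx : x ≠ 0)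
    (h : 0 ≤ x.valuation + mu G) :
    ∃ L : IwasawaAlgebra p, L ≠ 0 ∧
      iwasawaToPowerSeries p L = PowerSeries.C x * iwasawaToPowerSeries p G ∧
      (mu L : ℤ) = x.valuation + mu G := by
  have hp : (p : ℚ_[p]) ≠ 0 := by exact_mod_cast (Fact.out : p.Prime).ne_zero
  set y : ℚ_[p] := x * (p : ℚ_[p]) ^ mu G with hy
  have hy0 : y ≠ 0 := mul_ne_zero hx (pow_ne_zero _ hp)
  have hyval : y.valuation = x.valuation + mu G := by
    rw [hy, Padic.valuation_mul hx (pow_ne_zero _ hp), Padic.valuation_pow, Padic.valuation_p]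
    ring
  have hynorm : ‖y‖ ≤ 1 := by
    rw [Padic.norm_le_one_iff_val_nonneg, hyval]; exact h
  let y₀ : ℤ_[p] := ⟨y, hynorm⟩
  have hy₀c : (y₀ : ℚ_[p]) = y := rfl
  have hy₀0 : y₀ ≠ 0 := by
    intro h0
    apply hy0
    rw [← hy₀c, h0]
    rfl
  have hred : red (pfree G) ≠ 0 := red_pfree_ne_zero hG
  refine ⟨PowerSeries.C y₀ * pfree G, mul_ne_zero ?_ (pfree_ne_zero hG), ?_, ?_⟩
  · rw [Ne, ← map_zero (PowerSeries.C (R := ℤ_[p])), PowerSeries.C_injective.eq_iff]; exact hy₀0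
  · simp only [map_mul, iwasawaToPowerSeries_C, TameBranchAnalyticSha.iota_eq_C_pow_mu_mul_iota_pfree G, ← mul_assoc,
      hy₀c, hy]
  · rw [mu_C_mul_of_red_ne_zero hy₀0 hred]
    have : ((y₀.valuation : ℕ) : ℤ) = y.valuation := by
      rw [← PadicInt.valuation_coe]
    rw [this, hyval]

/-- **Rescaling, uniqueness of `μ`.** `G, L ∈ Λ ∖ 0`, `x ∈ ℚ_p ∖ 0`, `ι L = x · ι G`: then
`ord_p x + μ(G) ≥ 0` and `μ(L) = ord_p x + μ(G)`. [folklore] -/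
theorem mu_eq_of_iwasawaToPowerSeries_eq_C_mul {G L : IwasawaAlgebra p} (hG : G ≠ 0) (hL : L ≠ 0)
    {x : ℚ_[p]} (hx : x ≠ 0)
    (h : iwasawaToPowerSeries p L = PowerSeries.C x * iwasawaToPowerSeries p G) :
    0 ≤ x.valuation + mu G ∧ (mu L : ℤ) = x.valuation + mu G := by
  have hp : (p : ℚ_[p]) ≠ 0 := by exact_mod_cast (Fact.out : p.Prime).ne_zero
  set y : ℚ_[p] := x * (p : ℚ_[p]) ^ mu G with hy
  have hy0 : y ≠ 0 := mul_ne_zero hx (pow_ne_zero _ hp)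
  have hyval : y.valuation = x.valuation + mu G := by
    rw [hy, Padic.valuation_mul hx (pow_ne_zero _ hp), Padic.valuation_pow, Padic.valuation_p]
    ring
  have hred : red (pfree G) ≠ 0 := red_pfree_ne_zero hG
  -- `ι L = C y · ι (pfree G)`
  have hL' : iwasawaToPowerSeries p L = PowerSeries.C y * iwasawaToPowerSeries p (pfree G) := by
    rw [h, TameBranchAnalyticSha.iota_eq_C_pow_mu_mul_iota_pfree G, ← mul_assoc, ← map_mul]
  by_cases hnn : 0 ≤ y.valuation
  · -- integral case: `L = C y₀ · pfree G`
    have hynorm : ‖y‖ ≤ 1 := by rw [Padic.norm_le_one_iff_val_nonneg]; exact hnn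
    let y₀ : ℤ_[p] := ⟨y, hynorm⟩
    have hy₀c : (y₀ : ℚ_[p]) = y := rfl
    have hy₀0 : y₀ ≠ 0 := by
      intro h0
      apply hy0
      rw [← hy₀c, h0]
      rfl
    have hLeq : L = PowerSeries.C y₀ * pfree G := by
      apply iwasawaToPowerSeries_injective p
      simp only [map_mul, iwasawaToPowerSeries_C, hL', hy₀c]
    have hval : ((y₀.valuation : ℕ) : ℤ) = y.valuation := by rw [← PadicInt.valuation_coe]
    refine ⟨hyval ▸ hnn, ?_⟩
    rw [hLeq, mu_C_mul_of_red_ne_zero hy₀0 hred, hval, hyval]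
  · -- non-integral case is impossible: `C(p^k) · L = C u · pfree G` with `u` a unit, `k > 0`
    exfalso
    push Not at hnn
    set k : ℕ := (-y.valuation).toNat with hk
    have hkpos : 0 < k := by rw [hk]; omega
    have hkval : (k : ℤ) = -y.valuation := by rw [hk]; omega
    set z : ℚ_[p] := y * (p : ℚ_[p]) ^ k with hz
    have hz0 : z ≠ 0 := mul_ne_zero hy0 (pow_ne_zero _ hp)
    have hzval : z.valuation = 0 := by
      rw [hz, Padic.valuation_mul hy0 (pow_ne_zero _ hp), Padic.valuation_pow, Padic.valuation_p]
      omega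
    have hznorm : ‖z‖ = 1 := by
      rw [Padic.norm_eq_zpow_neg_valuation hz0, hzval, neg_zero, zpow_zero]
    let z₀ : ℤ_[p] := ⟨z, hznorm.le⟩
    have hz₀c : (z₀ : ℚ_[p]) = z := rfl
    have hz₀u : IsUnit z₀ := by rw [PadicInt.isUnit_iff]; exact hznorm
    have hLeq : PowerSeries.C ((p : ℤ_[p]) ^ k) * L = PowerSeries.C z₀ * pfree G := by
      apply iwasawaToPowerSeries_injective p
      simp only [map_mul, map_pow, iwasawaToPowerSeries_C, hL', hz₀c, hz, PadicInt.coe_natCast]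
      ring
    have hμ := congrArg mu hLeq
    rw [(mu_and_pfree_C_pow_mul hL k).1,
      (mu_eq_and_pfree_eq (red_C_mul_ne_zero_of_isUnit hz₀u hred)
        (by rw [pow_zero, map_one, one_mul]) :
          mu (PowerSeries.C z₀ * pfree G) = 0 ∧ _).1] at hμ
    omega

end Rescale

section Bookkeeping

variable {W W' : WeierstrassCurve ℚ} [W.IsElliptic] [W'.IsElliptic] [W.IsGloballyMinimal]
  [W'.IsGloballyMinimal]

/-- Good ordinary reduction at `2` is an isogeny invariant (good reduction: Serre–Tate / *AEC* VII.7.2,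
tree theorem `IsIsogenous.hasGoodReductionAtPrime_iff`; `a₂` is an isogeny invariant:
`frobeniusTrace_eq_of_isIsogenous`). [cite: SilvermanAEC2009, Cor. VII.7.2] -/
theorem isOrdinaryAt_of_isIsogenous (hiso : IsIsogenous W W') (hord : IsOrdinaryAt W 2) :
    IsOrdinaryAt W' 2 := by
  have hgood' : W'.HasGoodReductionAtPrime 2 := (hiso.hasGoodReductionAtPrime_iff 2).mp hord.1
  refine ⟨hgood', ?_⟩
  rw [← frobeniusTrace_eq_of_isIsogenous hiso 2 hord.1 hgood']
  exact hord.2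

/-- The unit root `α` of `X² − a₂X + 2` is an isogeny invariant (it only depends on `a₂`). [folklore] -/
theorem unitRoot_eq_of_isIsogenous (hiso : IsIsogenous W W') (hord : IsOrdinaryAt W 2) :
    unitRoot W' 2 = unitRoot W 2 := by
  have hgood' : W'.HasGoodReductionAtPrime 2 := (hiso.hasGoodReductionAtPrime_iff 2).mp hord.1
  unfold unitRoot
  rw [frobeniusTrace_eq_of_isIsogenous hiso 2 hord.1 hgood']

omit [W.IsGloballyMinimal] [W'.IsGloballyMinimal] in
/-- `L(E,1) ≠ 0` is an isogeny invariant (`entireLFunction_eq_of_isIsogenous'`, Faltings / Knapp 11.67).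
[cite: Knapp1993, Thm. 11.67] -/
theorem entireLFunction_one_ne_zero_of_isIsogenous (hiso : IsIsogenous W W')
    (hL : W.entireLFunction 1 ≠ 0) : W'.entireLFunction 1 ≠ 0 := by
  rwa [← entireLFunction_eq_of_isIsogenous' hiso]

end Bookkeeping

end Summit.BirchSwinnertonDyer.BirchSwinnertonDyer.Theorems.IsogenyMuShift

end
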